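import Literature.AlgebraicGeometry.ShimuraVarieties.KudlaRapoport2013.Sec2Defs
import Mathlib.Algebra.BigOperators.Finprod
import Mathlib.Analysis.SpecialFunctions.Complex.Log
import Mathlib.Combinatorics.Enumerative.Composition
import Mathlib.LinearAlgebra.Matrix.PosDef
import Mathlib.NumberTheory.NumberField.ClassNumber
import Mathlib.NumberTheory.NumberField.Units.Basic
import HarnessLib

/-!
# Kudla–Rapoport 2013, §11 «The main theorem and a conjecture» and §12 «The arithmetic degree in the non-degenerate case»
# — the numbered statements (named facts over a posited datum, no proofs)

[KudlaRapoport2013] = S. Kudla, M. Rapoport, *Special cycles on unitary Shimura varieties II: global theory*, J. reine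
angew. Math. **697** (2014) = arXiv 0912.3758.  SOURCES READ: the v2 page text (squad kit
`T/KR/TKR-t02/g0/KR2013-arXivv2-pages.txt`, pp. 42–48; pins «(arXiv v2 p. N)», ruling R-1) and the held v1 TeX
`paper:arxiv-0912.3758` chunks p0029–p0033 for the formulas.  v1 ↔ v2: the numbered items Def. 11.1, Prop. 11.2, Rem. 11.3,
Def. 11.4, Rem. 11.5, Prop. 11.6, Cor. 11.7, Thm. 11.8, Thm. 11.9, Conj. 11.10, Lem. 12.1, Lem. 12.2 and the displays
(11.1)–(11.6), (12.1)–(12.7) carry the SAME numbers in v1 (pp. 52–60) and v2 (pp. 42–48); two wording deltas, v2 followed: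
Thm. 11.8 names the nearly self-dual lattices `M ⊂ M*`, `M*/M ≃ 𝒪_k/p𝒪_k` and `r_gen(T, V_T) = Σ_{[[M]]} r_gen(T, M)` (v1: `L̃'`), and
Thm. 11.9 has `C₁ = (−1)ⁿ (w_k/h_k) vol(G₁^{V_T}(ℝ)) vol(K₁)` (v1 without the sign `(−1)ⁿ`).

STANDING (Parts III–IV of the paper): signature `(n−1, 1)` (`r = 1`), `𝓜 = 𝓜(n−1,1) ×_{Spec 𝒪_k} 𝓜₀` (Notation 2.6), special
cycles `Z(T) → 𝓜` for `T ∈ Herm_m(𝒪_k)` (Def. 2.8), `Diff₀(T)` (Prop. 2.22).  The imaginary quadratic field `k`, `𝒪_k`, `σ`,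
`Herm_m(𝒪_k)_{>0}`, `Diff₀`, inert ∕ ramified primes and `δ` are the tree's ★ `KudlaRapoport2013.Sec2Defs` (seat TKR-t01:
`IsPosDefHerm`, `diff0`, `IsInertPrime`, `IsRamifiedPrime`, `numRamifiedPrimes`, the datum `Sec2Core k`) — imported, not restated;
`h_k` = Mathlib `NumberField.classNumber k`.

## The posited datum `Sec11Data C` (what is REAL, what is ⟨CARRIER⟩)

REAL: everything arithmetic — `T`, its diagonal blocks for an ordered partition of `n` (Mathlib `Composition n`), `r⁰(T)`
(`radicalDim`: `n − rank` of `T mod p` over `𝒪_k/p𝒪_k`), «`T` is `GL_n(𝒪_{k,p})`-equivalent to `diag(1_{n−2}, p^a, p^b)`»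
(`HasLocalDiagonalType`, READING R1 below), `μ_p(T)` (`muP`), `h_k` (Mathlib `NumberField.classNumber`), `w_k` (Mathlib
`NumberField.Units.torsionOrder` = `|𝒪_k^×_{tors}|`, the number of roots of unity; Thm. 11.8: `h_k/w_k` «is the degree of the stack
`𝓜₀ = [𝒪_k^× \ Spec 𝒪_H]`»), `δ`, `q^T = e(tr(Tz))` (`qPow`) on
the hermitian upper half-space (`hermUpperHalfSpace`, §7 p. 31: «`D(W₀) ≃ {z ∈ M_n(ℂ) ∣ v(z) := (2i)⁻¹(z − ᵗz̄) > 0}`»), the sums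
`Σ_p χ_p log p` (Def. 11.4) and `length · log p` (Cor. 11.7) as REAL functions of the carriers.
⟨CARRIER⟩ (no Lean vocabulary; meaning = the docstring; junk off the stated domain): the dimensions of the irreducible components
of the stack `Z(T)` and of `Z(T) ∩ 𝓜_p`; the Euler–Poincaré characteristics `χ(Z(T)_p, 𝒪_{Z(T₁)} ⊗^𝕃 ⋯ ⊗^𝕃 𝒪_{Z(T_r)})` (stacky,
[10] VI 4.1); the (stacky) length of the `0`-cycle `Z(T)`; the representation numbers `r_gen(T, V_T)` of (7.6) summed over genera of
nearly self-dual lattices; the Fourier coefficients `E'_T(z, 0, Ṽ)` and `E'_T(z, 0)` of the derivatives of the incoherent Eisenstein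
series (11.5) (§9 (9.1)) as functions of `z`; `vol(G₁^{V_T}(ℝ))`, `vol(K₁)` (§7–§8 normalisation); for §12 the lengths of `Z(x°)`
and of `Ẑ^{(V♯,V₀),ss}(T)`, the stack cardinality of `[(I^V(ℚ) × I^{V₀}(ℚ))\Inc_p(T;V♯,V₀)(F)]` and `r_gen(T, L̃')`, indexed by the
pairs `(V♯, V₀)` of (12.1) through the tree's `Sec2Core.RelevantSharp` and ★ `HermSpace ℚ k`.  Nothing in the datum asserts a
statement of §11–§12; those are the predicates `def KR2013_11_… (D : Sec11Data C) … : Prop` below (Conjecture 11.10 is quoted in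
the census and deliberately NOT typed: conjectures are not Literature facts).

READING R1 («`T` is `GL_n(𝒪_{k,p})`-equivalent to `diag(1_{n−2}, p^a, p^b)` with `0 ≤ a < b`», Prop. 11.2 (i) ∕ Thm. 11.8, `p` inert,
`p > 2`): over the unramified quadratic extension `𝒪_{k,p}/ℤ_p` a hermitian lattice is an orthogonal sum of scaled unimodular lattices
and unimodular hermitian lattices are diagonalisable with unit entries (Jacobowitz, cited in the paper as [24] §7 at Lem. 12.1), so
`T ≃ diag(p^{a₁}, …, p^{aₙ})` with `a₁ ≤ ⋯ ≤ aₙ` the elementary divisors of `T` at `𝔭 = p𝒪_k`, read off the determinantal divisors: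
`v_𝔭`(ideal of `j × j` minors of `T`) `= a₁ + ⋯ + a_j`.  Hence the printed condition is: the `(n−2) × (n−2)` minors generate an ideal
prime to `𝔭`, the `(n−1) × (n−1)` minors generate an ideal of `𝔭`-order `a`, and `det T` has `𝔭`-order `a + b` (`v_𝔭(I) = e` typed as
`I ≤ 𝔭^e ∧ ¬ I ≤ 𝔭^{e+1}` in the Dedekind domain `𝒪_k`); `n ≥ 2` for the shape `diag(1_{n−2}, p^a, p^b)` to make sense.
READING R2 (Cor. 11.7 «`⟨Z(T₁), …, Z(T_r)⟩_T = length(Z(T)) · log p`»): the prime `p` is the one of (11.4), `Diff₀(T) = {p}`, made an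
explicit hypothesis.  READING R3 (Def. 11.1 «of pure dimension `n − m`»): the empty stack counts as pure of every dimension (Thms.
11.8∕11.9 assume «non-degenerate with `Z(T) ≠ ∅`» separately), so non-degenerate = every irreducible component has dimension `n − m`.

## Census (v2 pages)

| item | disposition |
|---|---|
| Def. 11.1 (p. 42) non-degenerate `T` ∕ `Z(T)` | `Sec11Data.IsNonDegenerate` (REAL predicate on the ⟨CARRIER⟩ component dimensions; R3). |
| Prop. 11.2 (i), (ii) (p. 42) | `KR2013_11_2_i` (`dim Z(T) = [(r⁰(T) − 1)/2]` and the non-degeneracy criterion, R1), `KR2013_11_2_ii`. |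
| Rem. 11.3 (p. 42) (ramified primes and `p = 2` open) | census only (prose). |
| (11.2) (p. 42) `Z(T₁) ×_𝓜 ⋯ ×_𝓜 Z(T_r) = ∐_T Z(T)` by the fundamental matrix | not typed (fibre products of stacks; the blocks `T_i` of `T` are REAL: `diagBlock`). |
| Def. 11.4 (11.3) (p. 43) `⟨Z(T₁), …, Z(T_r)⟩_T = Σ_p χ(Z(T)_p, ⊗^𝕃 𝒪_{Z(T_i)}) log p` | `Sec11Data.pairing` (REAL over the ⟨CARRIER⟩ `chi`) + `KR2013_11_4_finite` («the sum … [is] finite», by Prop. 2.22). |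
| Rem. 11.5 (p. 43) blocks of a non-degenerate `T` are non-degenerate | `KR2013_11_5`. |
| (11.4) + the two surrounding sentences (p. 43): `|Diff₀(T)| > 1 ⇒ Z(T) = ∅`, `χ = 0`; `Diff₀(T) = {p} ⇒` supported at `p`; `Diff₀(T) = ∅ ⇒` empty or supported at ramified primes | `KR2013_11_eq_11_4`. |
| Prop. 11.6 (p. 43) `⊗^𝕃 = ⊗` for non-degenerate `T` | not typed (derived category of coherent sheaves on a DM stack). |
| Cor. 11.7 (p. 44) `⟨…⟩_T = length(Z(T)) log p =: deĝ(Z(T))`, independent of the blocks | `Sec11Data.arithDegree` (REAL over ⟨CARRIER⟩ `len`) + `KR2013_11_7` (R2). |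
| Thm. 11.8 (p. 44) `length(Z(T)) = μ_p(T) · (h_k/w_k) · r_gen(T, V_T)`, `μ_p(T) = ½ Σ_{l=0}^{a} p^l (a+b+1−2l)` | `muP` (REAL), `KR2013_11_8`; «`h_k/w_k` is the degree of `𝓜₀ = [𝒪_k^× \ Spec 𝒪_H]`» recorded. |
| (11.5) (p. 44) `E(z,s,V) = Σ_{[[L]]} E(z,s,L)`, `E(z,s) = Σ_V E(z,s,V)` | the ⟨CARRIER⟩ fields `eisDerivFourier` (for `Ṽ`) and `eisDerivFourierTotal`; the first equality of Thm. 11.9 relates them. |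
| Thm. 11.9 (p. 45) `E'_T(z,0) = E'_T(z,0,Ṽ) = C₁ · deĝ(Z(T)) · q^T`, `C₁ = (−1)ⁿ (w_k/h_k) vol(G₁^{V_T}(ℝ)) vol(K₁)` | `Sec11Data.C1` (REAL over ⟨CARRIER⟩ volumes), `KR2013_11_9`; «`vol(G₁^{V_T}(ℝ)) vol(K₁)` is a (stacky) Euler characteristic, Lem. 9.5» recorded. |
| the rephrasing after Thm. 11.9 (p. 45) with `⟨Z(T₁), …, Z(T_r)⟩_T` | = `KR2013_11_9` ∘ `KR2013_11_7` (no separate row). |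
| Conj. 11.10 (p. 45) «Let `T ∈ Herm_n(𝒪_k)_{>0}` with non-degenerate diagonal blocks `T₁, …, T_r` and assume that `Diff₀(T) = {p}` for `p > 2`. Suppose that `Z(T) ≠ ∅`. … Then `E'_T(z,0) = E'_T(z,0,Ṽ) = C₁ · ⟨Z(T₁), …, Z(T_r)⟩_T · q^T`.» | **NOT TYPED in Literature**: an open conjecture is not a Literature fact (gate lint `literature.conjecture`; CONVENTIONS: unproven conjectures live under `Summits/…/Theorems/` as `@[conjecture] def` when a route needs them — none does; the squad planner was told). Its shape is `KR2013_11_9`'s conclusion with `Sec11Data.pairing T π` in place of `arithDegree T p`, under the hypotheses of `KR2013_11_eq_11_4`. |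
| (11.6) (p. 45) `deĝ Z(T) := ⟨Z(t₁), …, Z(t_n)⟩_T` and the «conjecture includes ∕ implies» sentences (independence of the partition; `deĝ Z(T) = deĝ Z(T')` for `T' = g T ᵗḡ`) | `Sec11Data.arithDegreeGeneral` (REAL: the pairing at the all-ones composition — a DEFINITION, not the conjecture); the two consequence sentences are prose about Conj. 11.10 — recorded here, not typed. |
| (12.1) (p. 46) `Ẑ(T) = ∐_{(V♯,V₀)} Ẑ^{(V♯,V₀),ss}(T)` | the index of the §12 ⟨CARRIER⟩s (`RelevantSharp × HermSpace`); not typed as a statement (formal stacks). |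
| (12.2) (p. 46) `length(Z(x°)) = μ_p(T)` («By Theorem 5.1 of [39]» = [KudlaRapoport2011SpecialCyclesI]) | `KR2013_12_eq_12_2`. |
| (12.3) (p. 46) `length(Ẑ^{(V♯,V₀),ss}(T)) = μ_p(T) · |[(I^V(ℚ) × I^{V₀}(ℚ))\Inc_p(T;V♯,V₀)(F)]|` | `KR2013_12_eq_12_3`. |
| (12.4)–(12.5) (p. 46) `Z(x°)(F) = 𝒱(Λ)(F)` a single point; vertices of level `j` and type `t` | not typed (Bruhat–Tits strata of the RZ space `𝒩`, [39]). |
| Lem. 12.1 (p. 46) `G'(ℚ_p)⁰` acts transitively on the lattices of level `0` and type `t` in `Ṽ'_p` | not typed (hermitian `𝒪_{k,p}`-lattices in a `p`-adic hermitian space: no carrier; «easily checked, cf. [24], section 7»). |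
| (12.6)–(12.7) (p. 47) the description of `Inc_p(T;V♯,V₀)(F)`, `(L̃')*/L̃' ≃ 𝒪_k/p𝒪_k` | not typed (definitions inside the proof); «nearly self-dual» is the MEANING of the ⟨CARRIER⟩ `rGenNearly`. |
| «`|[I^{V₀}(ℚ)\G₁^{V₀}(𝔸_f^p)/K_{0,1}^p]| = (1/w_k)|k¹\k¹_{𝔸_f}/Ô_k^×| = h_k/(2^{δ−1} w_k)`» (p. 48) | recorded (step of the proof of Lem. 12.2; class number of the norm-one torus), not typed. |
| Lem. 12.2 (p. 48) stack cardinality `= h_k/(2^{δ−1} w_k) · r_gen(T, L̃')` | `KR2013_12_2`. |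

DEDUP: `rg 'cite: KudlaRapoport2013, (§1[12]|Theorem 11|Definition 11)'` = ∅ before this file; `Herm_{>0}`, `Diff₀`, `δ` from ★ `Sec2Defs`;
`h_k` Mathlib.  No instance, notation, axiom or proof; nothing here asserts that any statement of [KudlaRapoport2013] holds.
-/

open Matrix NumberField Finset
open scoped ComplexOrder

namespace Literature.AlgebraicGeometry.ShimuraVarieties.KudlaRapoport2013.Sec11Sec12MainTheorem

open Literature.AlgebraicGeometry.ShimuraVarieties.KudlaRapoport2013.Sec2Defs
  (IsPosDefHerm diff0 IsInertPrime IsRamifiedPrime numRamifiedPrimes Sec2Core)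
open Literature.NumberTheory.Automorphic.Liu2021.AppendixC (HermSpace)

/-! ## REAL arithmetic of §11–§12 -/

section Arithmetic

variable {k : Type} [Field k] [NumberField k] [IsTotallyComplex k] [Algebra.IsQuadraticExtension ℚ k]

/-- **`r⁰(T) = n − rank(red(T))`**, «the dimension of the radical of the hermitian form `red(T)` over `𝒪_k/p𝒪_k`» (Prop. 11.2 (i),
p. 42): `T mod p` over the residue ring `𝒪_k/p𝒪_k` (a field for `p` inert) and Mathlib's `Matrix.rank`. REAL.
[cite: KudlaRapoport2013, §11 Proposition 11.2 (i) (arXiv v2 p. 42)] -/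
noncomputable def radicalDim {m : ℕ} (T : Matrix (Fin m) (Fin m) (𝓞 k)) (p : ℕ) : ℕ :=
  m - (T.map (Ideal.Quotient.mk (Ideal.span {(p : 𝓞 k)}))).rank

/-- The ideal of `𝒪_k` generated by the `j × j` minors of `T` (the `j`-th determinantal divisor; READING R1 of Prop. 11.2 (i) ∕
Thm. 11.8). REAL. [cite: KudlaRapoport2013, §11 Proposition 11.2 (i) (arXiv v2 p. 42)] -/
def minorIdeal {m : ℕ} (T : Matrix (Fin m) (Fin m) (𝓞 k)) (j : ℕ) : Ideal (𝓞 k) :=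
  Ideal.span {d | ∃ ρ γ : Fin j ↪ Fin m, d = (T.submatrix ρ γ).det}

/-- `v_P(I) = e` for ideals of the Dedekind domain `𝒪_k`: `I ⊆ P^e` and `I ⊄ P^{e+1}` (READING R1). REAL.
[cite: KudlaRapoport2013, §11 Proposition 11.2 (i) (arXiv v2 p. 42)] -/
def HasIdealOrd (I P : Ideal (𝓞 k)) (e : ℕ) : Prop :=
  I ≤ P ^ e ∧ ¬ I ≤ P ^ (e + 1)

/-- **«`T` is `GL_n(𝒪_{k,p})`-equivalent to `diag(1_{n−2}, p^a, p^b)`»** (Prop. 11.2 (i) p. 42, Thm. 11.8 p. 44), READING R1: `n ≥ 2`,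
the `(n−2)`-minors of `T` generate an ideal prime to `𝔭 = p𝒪_k`, the `(n−1)`-minors an ideal of `𝔭`-order `a`, and `det T` has
`𝔭`-order `a + b` (elementary divisors `(0, …, 0, a, b)` at the inert prime `p`; the ordering `a < b` is imposed where printed). REAL.
[cite: KudlaRapoport2013, §11 Proposition 11.2 (i) (arXiv v2 p. 42)] -/
def HasLocalDiagonalType {n : ℕ} (T : Matrix (Fin n) (Fin n) (𝓞 k)) (p a b : ℕ) : Prop :=
  2 ≤ n ∧ HasIdealOrd (minorIdeal T (n - 2)) (Ideal.span {(p : 𝓞 k)}) 0 ∧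
    HasIdealOrd (minorIdeal T (n - 1)) (Ideal.span {(p : 𝓞 k)}) a ∧
    HasIdealOrd (Ideal.span {T.det}) (Ideal.span {(p : 𝓞 k)}) (a + b)

/-- **`μ_p(T) = ½ Σ_{l=0}^{a} p^l (a + b + 1 − 2l)`** (Thm. 11.8, p. 44; (12.2), p. 46, «By Theorem 5.1 of [39]»), as a rational function
of `(p, a, b)` where `T ≃ diag(1_{n−2}, p^a, p^b)`, `0 ≤ a < b` (the summands are computed in `ℚ`, no truncated subtraction). REAL.
[cite: KudlaRapoport2013, §11 Theorem 11.8 (arXiv v2 p. 44)] -/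
def muP (p a b : ℕ) : ℚ :=
  (1 / 2 : ℚ) * ∑ l ∈ range (a + 1), (p : ℚ) ^ l * ((a : ℚ) + b + 1 - 2 * l)

/-- The diagonal block `T_i ∈ Herm_{m_i}(𝒪_k)` of `T ∈ Herm_n(𝒪_k)` for an ordered partition `n = m₁ + ⋯ + m_r` (p. 42: «For positive
integers `m₁, …, m_r` with `Σ m_i = n`, we fix `T_i ∈ Herm_{m_i}(𝒪_k)` … `T` runs over elements of `Herm_n(𝒪_k)_{≥0}` with diagonal blocks
`T₁, …, T_r`»): Mathlib `Composition n` and `Composition.embedding`. REAL.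
[cite: KudlaRapoport2013, §11 (11.2) (arXiv v2 p. 42)] -/
def diagBlock {n : ℕ} (T : Matrix (Fin n) (Fin n) (𝓞 k)) (π : Composition n) (i : Fin π.length) :
    Matrix (Fin (π.blocksFun i)) (Fin (π.blocksFun i)) (𝓞 k) :=
  T.submatrix (π.embedding i) (π.embedding i)

/-- The hermitian upper half-space of degree `n`, «`{z ∈ M_n(ℂ) ∣ v(z) := (2i)⁻¹(z − ᵗz̄) > 0}`» (§7, p. 31), the domain of the Eisenstein
series `E(z, s, L)` of §8–§9. REAL (Mathlib `Matrix.PosDef`). [cite: KudlaRapoport2013, §7 (arXiv v2 p. 31)] -/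
def hermUpperHalfSpace (n : ℕ) : Set (Matrix (Fin n) (Fin n) ℂ) :=
  {z | ((2 * Complex.I)⁻¹ • (z - zᴴ)).PosDef}

/-- **`q^T = e(tr(Tz))`**, `e(x) = e^{2πix}` (§7, p. 31: «for `T ∈ Herm_n(ℂ)`, we write `q^T = e(tr(Tz))`»), for `T ∈ Herm_n(𝒪_k)` read in
`ℂ` through the fixed embedding `τ : k → ℂ` (§4). REAL. [cite: KudlaRapoport2013, §7 (arXiv v2 p. 31)] -/
noncomputable def qPow {n : ℕ} (τ : k →+* ℂ) (T : Matrix (Fin n) (Fin n) (𝓞 k)) (z : Matrix (Fin n) (Fin n) ℂ) : ℂ :=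
  Complex.exp (2 * Real.pi * Complex.I * (T.map (fun a => τ (a : k)) * z).trace)

end Arithmetic

/-! ## The posited datum of §11–§12 -/

/-- **The posited datum of [KudlaRapoport2013] §11–§12** over the §2 datum `C : Sec2Core k` (the moduli problem `𝓜 = 𝓜(n−1,1) × 𝓜₀` and
its special cycles `Z(T)`, seat TKR-t01), in signature `(n−1, 1)`.  ⟨CARRIER⟩ fields (see the module docstring; each is junk off the
stated domain): `cycleDims T` = the set of dimensions of the irreducible components of `Z(T)` (`T ∈ Herm_m(𝒪_k)`; `∅` iff `Z(T) = ∅`);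
`fibreDims T p` = the same for `Z(T) ∩ 𝓜_p = Z(T) ×_{Spec 𝒪_k} Spec 𝔽_p`; `chi T π p = χ(Z(T)_p, 𝒪_{Z(T₁)} ⊗^𝕃 ⋯ ⊗^𝕃 𝒪_{Z(T_r)})` for the
blocks `T_i` of `T` cut out by the composition `π` (Def. 11.4, stacky Euler–Poincaré characteristic [10] VI 4.1); `len T` = the (stacky,
hence rational) length of the `0`-dimensional `Z(T)` (Cor. 11.7, Thm. 11.8); `rGen T = r_gen(T, V_T) = Σ_{[[M]]} r_gen(T, M)` (Thm.
11.8, (7.6)); `eisDerivFourier T z = E'_T(z, 0, Ṽ)` and `eisDerivFourierTotal T z = E'_T(z, 0)`, the `T`-th Fourier coefficients of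
`∂/∂s` at `s = 0` of the incoherent Eisenstein series (11.5) for `Ṽ` (the relevant space locally isomorphic to `V_T` off `∞, p`), resp. of
`E(z, s) = Σ_V E(z, s, V)` (Thm. 11.9); `volGR T = vol(G₁^{V_T}(ℝ))`, `volK1 T = vol(K₁)` (Thm. 11.9, measures of §7–§8); for §12,
indexed by a pair `(V♯, V₀)` of (12.1) given as `P : C.RelevantSharp` and `V₀ : HermSpace ℚ k`: `lenFormal T` = `length(Z(x°))`
((12.2)), `lenHat T P V₀ = length(Ẑ^{(V♯,V₀),ss}(T))`, `incCard T P V₀ = |[(I^V(ℚ) × I^{V₀}(ℚ))\Inc_p(T;V♯,V₀)(F)]|` (stack cardinality,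
(12.3)), `rGenNearly T P V₀ = r_gen(T, L̃')` for the nearly self-dual lattice `L̃'` of (12.7).  REAL: `τ` and `r = 1`.  Nothing is
asserted by the datum. [cite: KudlaRapoport2013, §11–§12 (arXiv v2 pp. 42–48)] -/
structure Sec11Data {k : Type} [Field k] [NumberField k] [IsTotallyComplex k] [Algebra.IsQuadraticExtension ℚ k]
    (C : Sec2Core k) : Type 1 where
  /-- «we fix an embedding `τ` of `k` into `ℂ`» (§4; needed for `q^T`). REAL. -/
  τ : k →+* ℂ
  /-- signature `(n−1, 1)`: `r = 1` (standing in Parts III–IV). -/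
  r_eq_one : C.r = 1
  /-- ⟨CARRIER⟩ dimensions of the irreducible components of `Z(T)`, `T ∈ Herm_m(𝒪_k)`. -/
  cycleDims : ∀ {m : ℕ}, Matrix (Fin m) (Fin m) (𝓞 k) → Set ℕ
  /-- ⟨CARRIER⟩ dimensions of the irreducible components of `Z(T) ∩ 𝓜_p`. -/
  fibreDims : ∀ {m : ℕ}, Matrix (Fin m) (Fin m) (𝓞 k) → ℕ → Set ℕ
  /-- ⟨CARRIER⟩ `χ(Z(T)_p, 𝒪_{Z(T₁)} ⊗^𝕃 ⋯ ⊗^𝕃 𝒪_{Z(T_r)})` (Def. 11.4), blocks from `π`. -/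
  chi : Matrix (Fin C.n) (Fin C.n) (𝓞 k) → Composition C.n → ℕ → ℤ
  /-- ⟨CARRIER⟩ `length(Z(T))` for `0`-dimensional `Z(T)` (stacky, rational). -/
  len : Matrix (Fin C.n) (Fin C.n) (𝓞 k) → ℚ
  /-- ⟨CARRIER⟩ `r_gen(T, V_T) = Σ_{[[M]]} r_gen(T, M)` over the genera of nearly self-dual lattices in `V_T` (Thm. 11.8). -/
  rGen : Matrix (Fin C.n) (Fin C.n) (𝓞 k) → ℚ
  /-- ⟨CARRIER⟩ `z ↦ E'_T(z, 0, Ṽ)` (Thm. 11.9, (11.5)). -/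
  eisDerivFourier : Matrix (Fin C.n) (Fin C.n) (𝓞 k) → Matrix (Fin C.n) (Fin C.n) ℂ → ℂ
  /-- ⟨CARRIER⟩ `z ↦ E'_T(z, 0)` for `E(z, s) = Σ_V E(z, s, V)` (Thm. 11.9). -/
  eisDerivFourierTotal : Matrix (Fin C.n) (Fin C.n) (𝓞 k) → Matrix (Fin C.n) (Fin C.n) ℂ → ℂ
  /-- ⟨CARRIER⟩ `vol(G₁^{V_T}(ℝ))` (Thm. 11.9; measure of §7). -/
  volGR : Matrix (Fin C.n) (Fin C.n) (𝓞 k) → ℝ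
  /-- ⟨CARRIER⟩ `vol(K₁)`, `K₁ ⊂ G₁^{Ṽ}(𝔸_f)` the stabilizer of a self-dual lattice `L̃ ⊂ Ṽ` (Thm. 11.9; measure of §8). -/
  volK1 : Matrix (Fin C.n) (Fin C.n) (𝓞 k) → ℝ
  /-- ⟨CARRIER⟩ `length(Z(x°))`, `Z(x°) ⊂ 𝒩` (§12 (12.2)). -/
  lenFormal : Matrix (Fin C.n) (Fin C.n) (𝓞 k) → ℚ
  /-- ⟨CARRIER⟩ `length(Ẑ^{(V♯,V₀),ss}(T))` ((12.3)), pair `(V♯, V₀)` of (12.1). -/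
  lenHat : Matrix (Fin C.n) (Fin C.n) (𝓞 k) → C.RelevantSharp → HermSpace ℚ k → ℚ
  /-- ⟨CARRIER⟩ the stack cardinality `|[(I^V(ℚ) × I^{V₀}(ℚ))\Inc_p(T;V♯,V₀)(F)]|` ((12.3), Lem. 12.2). -/
  incCard : Matrix (Fin C.n) (Fin C.n) (𝓞 k) → C.RelevantSharp → HermSpace ℚ k → ℚ
  /-- ⟨CARRIER⟩ `r_gen(T, L̃')`, `L̃'` the nearly self-dual lattice (12.7) of the pair (Lem. 12.2). -/
  rGenNearly : Matrix (Fin C.n) (Fin C.n) (𝓞 k) → C.RelevantSharp → HermSpace ℚ k → ℚ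

namespace Sec11Data

variable {k : Type} [Field k] [NumberField k] [IsTotallyComplex k] [Algebra.IsQuadraticExtension ℚ k]
variable {C : Sec2Core k} (D : Sec11Data C)

/-- **Definition 11.1.**  Printed (p. 42): «A hermitian matrix `T ∈ Herm_m(𝒪_k)_{>0}` (and the corresponding special cycle `Z(T)`)
is called non-degenerate if `Z(T)` is of pure dimension `n − m`. In particular, in the special case `m = 1` any `T = t ∈ ℤ_{>0}` is
non-degenerate.»  TYPED on the ⟨CARRIER⟩ component dimensions (READING R3; meaningful for `m ≤ n`).
[cite: KudlaRapoport2013, §11 Definition 11.1 (arXiv v2 p. 42)] -/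
def IsNonDegenerate {m : ℕ} (T : Matrix (Fin m) (Fin m) (𝓞 k)) : Prop :=
  D.cycleDims T ⊆ {C.n - m}

/-- **Definition 11.4 (11.3).**  Printed (p. 43): «For `T ∈ Herm_n(𝒪_k)_{>0}` with non-degenerate diagonal blocks `T₁, …, T_r`, let
`⟨Z(T₁), …, Z(T_r)⟩_T = Σ_p χ(Z(T)_p, 𝒪_{Z(T₁)} ⊗^𝕃 ⋯ ⊗^𝕃 𝒪_{Z(T_r)}) log p`. Here `Z(T)_p` denotes the part of `Z(T)` with support in the
fiber at `p`.»  REAL over the ⟨CARRIER⟩ `chi` (`Σᶠ` over `p ∈ ℕ`; finiteness of the support = `KR2013_11_4_finite`).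
[cite: KudlaRapoport2013, §11 Definition 11.4 (11.3) (arXiv v2 p. 43)] -/
noncomputable def pairing (T : Matrix (Fin C.n) (Fin C.n) (𝓞 k)) (π : Composition C.n) : ℝ :=
  ∑ᶠ p : ℕ, (D.chi T π p : ℝ) * Real.log p

/-- **`deĝ(Z(T)) := length(Z(T)) · log p`**, the arithmetic degree of the `0`-cycle `Z(T)` (Cor. 11.7, p. 44; `Diff₀(T) = {p}`, R2).
REAL over the ⟨CARRIER⟩ `len`. [cite: KudlaRapoport2013, §11 Corollary 11.7 (arXiv v2 p. 44)] -/
noncomputable def arithDegree (T : Matrix (Fin C.n) (Fin C.n) (𝓞 k)) (p : ℕ) : ℝ :=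
  (D.len T : ℝ) * Real.log p

/-- **`C₁ = (−1)ⁿ (w_k/h_k) vol(G₁^{V_T}(ℝ)) vol(K₁)`** (Thm. 11.9, p. 45; v1 without the sign).  REAL over the ⟨CARRIER⟩ volumes, with
`h_k = NumberField.classNumber k` and `w_k = NumberField.Units.torsionOrder k` (Mathlib). [cite: KudlaRapoport2013, §11 Theorem 11.9 (arXiv v2 p. 45)] -/
noncomputable def C1 (T : Matrix (Fin C.n) (Fin C.n) (𝓞 k)) : ℝ :=
  (-1 : ℝ) ^ C.n * ((NumberField.Units.torsionOrder k : ℝ) / (NumberField.classNumber k : ℝ)) * D.volGR T * D.volK1 T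

/-- **(11.6) `deĝ Z(T) := ⟨Z(t₁), …, Z(t_n)⟩_T`** (p. 45), `t₁, …, t_n ∈ ℤ_{>0}` the diagonal entries of `T`: the pairing at the all-ones
composition (every block of size `1`; size-`1` blocks are non-degenerate by Def. 11.1). REAL over `pairing`.
[cite: KudlaRapoport2013, §11 (11.6) (arXiv v2 p. 45)] -/
noncomputable def arithDegreeGeneral (T : Matrix (Fin C.n) (Fin C.n) (𝓞 k)) : ℝ :=
  D.pairing T (Composition.ones C.n)

end Sec11Data

/-! ## The numbered statements of §11 -/

section Statements

variable {k : Type} [Field k] [NumberField k] [IsTotallyComplex k] [Algebra.IsQuadraticExtension ℚ k]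
variable {C : Sec2Core k}

/-- **Proposition 11.2 (i).**  Printed (p. 42): «For `T ∈ Herm_n(𝒪_k)_{>0}`, suppose that `Z(T) ≠ ∅`. (i) Suppose that `Diff₀(T) = {p}`
for `p > 2`. Let `r⁰(T) = n − rank(red(T))` … Then `Z(T)` is equidimensional of dimension `dim Z(T) = [(r⁰(T) − 1)/2]`. In particular, `T`
is non-degenerate if and only if `T` is `GL_n(𝒪_{k,p})`-equivalent to `diag(1_{n−2}, p^a, p^b)` with `0 ≤ a < b`.»  TYPED over the datum
(R1 for the equivalence; `[·]` = integer part, `Nat` division; the «in particular» clause for `n ≥ 2`).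
[cite: KudlaRapoport2013, §11 Proposition 11.2 (i) (arXiv v2 p. 42)] -/
def KR2013_11_2_i (D : Sec11Data C) : Prop :=
  ∀ (T : Matrix (Fin C.n) (Fin C.n) (𝓞 k)) (p : ℕ), IsPosDefHerm k T → (D.cycleDims T).Nonempty →
    diff0 k T = {p} → 2 < p →
      D.cycleDims T = {(radicalDim T p - 1) / 2} ∧
        (2 ≤ C.n → (D.IsNonDegenerate T ↔ ∃ a b : ℕ, a < b ∧ HasLocalDiagonalType T p a b))

/-- **Proposition 11.2 (ii).**  Printed (p. 42): «Conversely, suppose that `T ∈ Herm_n(𝒪_k)_{>0}` and that, for an odd unramified prime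
`p`, `Z(T) ∩ 𝓜_p` is a nonempty `0`-cycle. Then `T` is non-degenerate with `Diff₀(T) = {p}`.»  TYPED over the datum (`p` odd prime, not
ramified; the fibre `Z(T) ∩ 𝓜_p` nonempty with all components of dimension `0`).
[cite: KudlaRapoport2013, §11 Proposition 11.2 (ii) (arXiv v2 p. 42)] -/
def KR2013_11_2_ii (D : Sec11Data C) : Prop :=
  ∀ (T : Matrix (Fin C.n) (Fin C.n) (𝓞 k)) (p : ℕ), IsPosDefHerm k T → p.Prime → p ≠ 2 → ¬ IsRamifiedPrime k p →
    D.fibreDims T p = {0} → D.IsNonDegenerate T ∧ diff0 k T = {p}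

/-- **Definition 11.4, finiteness.**  Printed (p. 43): «Note that by Proposition 2.22, `Z(T)` has proper support in the special fiber of
at most finitely many primes `p`, so that the sum and the Euler–Poincaré characteristics appearing here are finite.»  TYPED: for
`T ∈ Herm_n(𝒪_k)_{>0}` with non-degenerate diagonal blocks, `p ↦ χ_p` has finite support.
[cite: KudlaRapoport2013, §11 Definition 11.4 (arXiv v2 p. 43)] -/
def KR2013_11_4_finite (D : Sec11Data C) : Prop :=
  ∀ (T : Matrix (Fin C.n) (Fin C.n) (𝓞 k)) (π : Composition C.n), IsPosDefHerm k T →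
    (∀ i, D.IsNonDegenerate (diagBlock T π i)) → (Function.support (D.chi T π)).Finite

/-- **Remark 11.5.**  Printed (p. 43): «Note that, if `T ∈ Herm_n(𝒪_k)_{>0}` is non-degenerate, then the diagonal blocks `T₁, …, T_r` are
automatically non-degenerate.»  TYPED over the datum for every ordered partition `π` of `n`.
[cite: KudlaRapoport2013, §11 Remark 11.5 (arXiv v2 p. 43)] -/
def KR2013_11_5 (D : Sec11Data C) : Prop :=
  ∀ (T : Matrix (Fin C.n) (Fin C.n) (𝓞 k)) (π : Composition C.n), IsPosDefHerm k T → D.IsNonDegenerate T →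
    ∀ i, D.IsNonDegenerate (diagBlock T π i)

/-- **(11.4) and its surrounding sentences.**  Printed (p. 43): «By Proposition 2.22, if `|Diff₀(T)| > 1`, the cycle `Z(T)` is empty and
the Euler–Poincaré characteristic is zero. On the other hand, if `Diff₀(T) = {p}`, then `Z(T)` is supported in the fiber over `p` of `𝓜`,
and (11.4) `⟨Z(T₁), …, Z(T_r)⟩_T = χ(Z(T), 𝒪_{Z(T₁)} ⊗^𝕃 ⋯ ⊗^𝕃 𝒪_{Z(T_r)}) log p`. Finally, if `Diff₀(T)` is empty, then `Z(T)` is either empty or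
supported in the fibers for `p` ramified in `k`, and the sum in (11.3) runs over such primes.»  TYPED over the datum for
`T ∈ Herm_n(𝒪_k)_{>0}` with non-degenerate blocks: the three support statements for `p ↦ χ_p` (so that `pairing` reduces to (11.4)).
[cite: KudlaRapoport2013, §11 (11.4) (arXiv v2 p. 43)] -/
def KR2013_11_eq_11_4 (D : Sec11Data C) : Prop :=
  ∀ (T : Matrix (Fin C.n) (Fin C.n) (𝓞 k)) (π : Composition C.n), IsPosDefHerm k T →
    (∀ i, D.IsNonDegenerate (diagBlock T π i)) →
      ((diff0 k T).Nontrivial → D.cycleDims T = ∅ ∧ ∀ p, D.chi T π p = 0) ∧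
      (∀ p, diff0 k T = {p} → ∀ q, q ≠ p → D.chi T π q = 0) ∧
      (diff0 k T = ∅ → ∀ q, D.chi T π q ≠ 0 → IsRamifiedPrime k q)

/-- **Corollary 11.7.**  Printed (p. 44): «For a non-degenerate `T ∈ Herm_n(𝒪_k)_{>0}` with diagonal blocks `T₁, …, T_r`,
`⟨Z(T₁), …, Z(T_r)⟩_T = length(Z(T)) · log p =: deĝ(Z(T))` is the arithmetic degree of the `0`-cycle `Z(T)`. In particular, this quantity
is independent of the choice of the sizes of the blocks `T_i` on the diagonal of `T`.»  TYPED over the datum with `Diff₀(T) = {p}`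
explicit (READING R2), for every ordered partition `π`.
[cite: KudlaRapoport2013, §11 Corollary 11.7 (arXiv v2 p. 44)] -/
def KR2013_11_7 (D : Sec11Data C) : Prop :=
  ∀ (T : Matrix (Fin C.n) (Fin C.n) (𝓞 k)) (π : Composition C.n) (p : ℕ), IsPosDefHerm k T → D.IsNonDegenerate T →
    diff0 k T = {p} → D.pairing T π = D.arithDegree T p

/-- **Theorem 11.8.**  Printed (p. 44): «Let `T ∈ Herm_n(𝒪_k)_{>0}` be non-degenerate with `Z(T) ≠ ∅` and with `Diff₀(T) = {p}` for some
`p > 2`. Then `length(Z(T)) = μ_p(T) · (h_k/w_k) · r_gen(T, V_T)`, with `μ_p(T) = ½ Σ_{l=0}^{a} p^l (a+b+1−2l)`, where `T` is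
`GL_n(𝒪_{k,p})`-equivalent to `diag(1_{n−2}, p^a, p^b)` with `0 ≤ a < b`», `r_gen(T, V_T) = Σ_{[[M]]} r_gen(T, M)` over the genera of nearly
self-dual lattices `M` in `V_T` (`r_gen(T, M)` defined by (7.6)).  TYPED over the datum (R1; `h_k` = Mathlib `classNumber`, `w_k` = Mathlib
`Units.torsionOrder`), as an identity in `ℚ`.
[cite: KudlaRapoport2013, §11 Theorem 11.8 (arXiv v2 p. 44)] -/
def KR2013_11_8 (D : Sec11Data C) : Prop :=
  ∀ (T : Matrix (Fin C.n) (Fin C.n) (𝓞 k)) (p a b : ℕ), IsPosDefHerm k T → D.IsNonDegenerate T →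
    (D.cycleDims T).Nonempty → diff0 k T = {p} → 2 < p → a < b → HasLocalDiagonalType T p a b →
      D.len T = muP p a b * ((NumberField.classNumber k : ℚ) / (NumberField.Units.torsionOrder k : ℚ)) * D.rGen T

/-- **Theorem 11.9 (the main theorem).**  Printed (p. 45): «Let `T ∈ Herm_n(𝒪_k)_{>0}` be non-degenerate with `Z(T) ≠ ∅` and with
`Diff₀(T) = {p}` for some `p > 2`. Let `V_T` be the positive definite hermitian space of dimension `n` determined by the matrix `T`. Then
`E'_T(z, 0) = E'_T(z, 0, Ṽ) = C₁ · deĝ(Z(T)) · q^T`, where `Ṽ ∈ 𝓡_{(n−1,1)}(k)` is the unique relevant hermitian space that is locally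
isomorphic to `V_T` at all primes other than `∞` and `p`, and `E(z, s, Ṽ)` is the corresponding incoherent Eisenstein series defined by
(11.5). Here `C₁ = (−1)ⁿ (w_k/h_k) vol(G₁^{V_T}(ℝ)) vol(K₁)`, for `K₁ ⊂ G₁^{Ṽ}(𝔸_f)` the stabilizer of a self-dual `𝒪_k`-lattice `L̃` in `Ṽ` and
for the measure normalized as in sections 7 and 8.» («Note that the factor `vol(G₁^{V_T}(ℝ)) vol(K₁)` is a (stacky) Euler characteristic,
cf. Lemma 9.5»; proof: Cor. 9.4 + Thm. 11.8.)  TYPED over the datum as two identities of functions on the hermitian upper half-space.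
[cite: KudlaRapoport2013, §11 Theorem 11.9 (arXiv v2 p. 45)] -/
def KR2013_11_9 (D : Sec11Data C) : Prop :=
  ∀ (T : Matrix (Fin C.n) (Fin C.n) (𝓞 k)) (p : ℕ), IsPosDefHerm k T → D.IsNonDegenerate T →
    (D.cycleDims T).Nonempty → diff0 k T = {p} → 2 < p →
      ∀ z ∈ hermUpperHalfSpace C.n,
        D.eisDerivFourierTotal T z = D.eisDerivFourier T z ∧
          D.eisDerivFourier T z = (D.C1 T : ℂ) * (D.arithDegree T p : ℂ) * qPow D.τ T z

/-! ## §12: (12.2), (12.3), Lemma 12.2 -/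

/-- **(12.2).**  Printed (p. 46): «By Theorem 5.1 of [39], the length of `Z(x°)` depends only on `T` and is equal to
`length(Z(x°)) = μ_p(T) = ½ Σ_{l=0}^{a} p^l (a + b + 1 − 2l)`» ([39] = [KudlaRapoport2011SpecialCyclesI]; `T` as in Thm. 11.8).  TYPED over
the ⟨CARRIER⟩ `lenFormal`. [cite: KudlaRapoport2013, §12 (12.2) (arXiv v2 p. 46)] -/
def KR2013_12_eq_12_2 (D : Sec11Data C) : Prop :=
  ∀ (T : Matrix (Fin C.n) (Fin C.n) (𝓞 k)) (p a b : ℕ), IsPosDefHerm k T → D.IsNonDegenerate T →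
    (D.cycleDims T).Nonempty → diff0 k T = {p} → 2 < p → a < b → HasLocalDiagonalType T p a b →
      D.lenFormal T = muP p a b

/-- **(12.3).**  Printed (p. 46): «Therefore, we have `length(Ẑ^{(V♯,V₀),ss}(T)) = μ_p(T) · |[(I^V(ℚ) × I^{V₀}(ℚ))\Inc_p(T;V♯,V₀)(F)]|`, where
the second factor on the right side is the (stack) cardinality of the quotient.»  TYPED over the §12 ⟨CARRIER⟩s for every pair
`(V♯, V₀)` of the decomposition (12.1) (`T` as in Thm. 11.8); the predicate quantifies over ALL pairs `(P, V₀)` — off (12.1) the three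
carriers are `0` by the junk convention of the datum, where the identity is trivially consistent (no membership carrier for (12.1) exists).
[cite: KudlaRapoport2013, §12 (12.3) (arXiv v2 p. 46)] -/
def KR2013_12_eq_12_3 (D : Sec11Data C) : Prop :=
  ∀ (T : Matrix (Fin C.n) (Fin C.n) (𝓞 k)) (p a b : ℕ) (P : C.RelevantSharp) (V₀ : HermSpace ℚ k), IsPosDefHerm k T →
    D.IsNonDegenerate T → (D.cycleDims T).Nonempty → diff0 k T = {p} → 2 < p → a < b → HasLocalDiagonalType T p a b →
      D.lenHat T P V₀ = muP p a b * D.incCard T P V₀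

/-- **Lemma 12.2.**  Printed (p. 48): «`|[(I^V(ℚ) × I^{V₀}(ℚ))\Inc_p(T;V♯,V₀)(F)]| = h_k/(2^{δ−1} w_k) · r_gen(T, L̃')`» (proof via
Lem. 12.1, the orbifold count `Σ_{L̃''} |Γ(L̃'')|⁻¹ |Ω(T, L̃'')| = r_gen(T, L̃')` and «`|[I^{V₀}(ℚ)\G₁^{V₀}(𝔸_f^p)/K_{0,1}^p]| = (1/w_k)|k¹\k¹_{𝔸_f}/Ô_k^×|
= h_k/(2^{δ−1} w_k)`», p. 48; «the right side here depends only on `Ṽ = Hom_k(V₀, V)` and the type of the genus in `V♯`»; with (12.2),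
(12.3) and the count `2^{δ−1}` of pairs this proves Thm. 11.8).  TYPED over the §12 ⟨CARRIER⟩s (`δ` = ★ `numRamifiedPrimes k ≥ 1`, so
`2^{δ−1}` is the printed power), for `T` as in Thm. 11.8 and every pair of (12.1) (quantified over all `(P, V₀)`; off (12.1) both sides
are `0` by the junk convention of the carriers `incCard`, `rGenNearly`).
[cite: KudlaRapoport2013, §12 Lemma 12.2 (arXiv v2 p. 48)] -/
def KR2013_12_2 (D : Sec11Data C) : Prop :=
  ∀ (T : Matrix (Fin C.n) (Fin C.n) (𝓞 k)) (p : ℕ) (P : C.RelevantSharp) (V₀ : HermSpace ℚ k), IsPosDefHerm k T →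
    D.IsNonDegenerate T → (D.cycleDims T).Nonempty → diff0 k T = {p} → 2 < p →
      D.incCard T P V₀ =
        (NumberField.classNumber k : ℚ) / (2 ^ (numRamifiedPrimes k - 1) * (NumberField.Units.torsionOrder k : ℚ)) * D.rGenNearly T P V₀

end Statements

end Literature.AlgebraicGeometry.ShimuraVarieties.KudlaRapoport2013.Sec11Sec12MainTheorem
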